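import Summits.CriticalPhenomena.Ising3DConformalLimit.Theses.PersistenceSpeed
import Summits.CriticalPhenomena.Ising3DConformalLimit.Theses.ArmHyperscaling
import Summits.CriticalPhenomena.Ising3DConformalLimit.Theorems.AnomalousForcesInteractionEtaPositiveOfOneArm
import Literature.Probability.LatticeModels.HighDimPointwiseTriviality
import Literature.Probability.LatticeModels.GKSInequalities
import Literature.Probability.LatticeModels.CriticalFKIsingBoxCrossingLower
import Literature.Probability.LatticeModels.CriticalEtaUpperDCPProofs
import Literature.Probability.LatticeModels.TwoPointSupNormMonotone
import Literature.Probability.LatticeModels.IsingTranslationInvariance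
import HarnessLib

/-!
# Disproof of `BoundedBoundarySignal` (stmt-CriticalPhenomena-18094) — findings of the birth attack

Crux (route PersistenceSpeed, rank 2; verbatim shape):
`∃ K ≥ 2, ∃ A, ∀ L ≥ 1, Σ_{x∈Λ_L} ⟨σ_x⟩⁺_{Λ_{KL};β_c(3),0} ≤ A · (Σ_{x,y∈Λ_L} ⟨σ₀σ_{x-y}⟩⁺_{β_c})^{1/2}`.
Notation: `lhs K L` = the boundary signal (left side), `bulk L` = the bulk variance sum (`sd_L²`),
`boxMag R = m⁺_R = ⟨σ₀⟩⁺_{Λ_R;β_c,0}` (the one-arm quantity of crux stmt-15591; the small vocabulary of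
`Cruxes/OneArmHyperscaling/Disproof.lean` §A–B is MIRRORED here, not imported, so that this file only depends on
landed modules), `axisTwoPoint n = ⟨σ₀σ_{2ne₀}⟩_{β_c}`.

**Verdict of this cycle (crux-attack at birth, refuter-rattack-stmt-CriticalPhenomena-18094-0): NO KILL — survives.**
Every quantity is genuine and finite (`β_c(3) = sInf{β ≥ 0 | m* > 0} > 0`, box limits exist by GKS, `bulk ≥ 1`), the
statement is faithful to its informal text (centred boxes, `h = 0`, `+` b.c., infinite-volume `+` state on the right),
not trivial (simp/norm_num/aesop/exact?/positivity fail on S and on ¬S), not vacuous, not a costume of the summit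
(`C → S`, `S → C` fail and are semantically independent), and it is IMPLIED (sorry-free, `bbs_of_oneArmHyperscaling`)
by `OneArmHyperscaling` (stmt-15591), whose own cheapest falsifier did not fire (MC j024350: one-arm exponent
0.50 ± 0.01 vs Δσ = 0.518, ratio saturating).  Finite-size scaling predicts both sides `≍ L^{3-Δσ}`.  A refutation
needs `lhs/√bulk → ∞` at EVERY `K ≥ 2` (`not_bbs_iff`) — an averaged one-arm exponent `< Δσ` on `ℤ³`, open; the
owned inequalities only pin the ratio inside a window of polynomial width `L^{3/2}` (`lhs_window`).

What IS proved here (sorry-free, standard axioms; the Negative/ landings `Negative/Dictionary.lean` and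
`Negative/WindowAndLadder.lean` carry the same content minus the positive composition):

* **A. Load-bearing analysis / dictionary.** `bbs_iff` (verbatim); `swapped_trivial` (the `∀ L ∃ A` order is empty:
  the order is load-bearing); `at_zero` (`1 ≤ L` is decoration); `witness_nonneg` (`A ≥ 0`); `slice_mono`,
  `bbs_iff_cofinal` (GKS: `K`-slices monotone, any larger aspect ratio works with the same constant);
  `bbs_false_without_hK` (**the `K = 0` slice is FALSE** — frozen block spins, `lhs 0 L ≥ 8L³` vs `√bulk ≲ L^{5/2}`:
  `2 ≤ K` is load-bearing only degenerately, every `K ≥ 1` slice is open); translation sandwich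
  `|Λ_L|·m⁺_{KL+L} ≤ lhs K L ≤ |Λ_L|·m⁺_{KL-L}` (`card_mul_boxMag_le_lhs`, `lhs_le_card_mul_boxMag` = the birth line's
  `stub_plusSumLe`); `bbs_iff_avgOneArm`: **BBS ⟺ `∃ K ≥ 1, ∃ A, ∀ L ≥ 1, |Λ_L|·m⁺_{KL} ≤ A·√bulk L`** — one-arm
  hyperscaling against the BOX-AVERAGED two-point function.
* **B. Position relative to crux stmt-15591 and the rigorous window.** `card_sq_mul_axis_le_bulk` (MMS:
  `|Λ_L|²·⟨σ₀σ_{6Le₀}⟩ ≤ bulk L`, the birth line's `stub_boxSumGe`); `bbs_of_oneArmHyperscaling`: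
  **`OneArmHyperscaling → BoundedBoundarySignal`** — the whole birth line composed (BBS is formally WEAKER; the
  converse would need a doubling property of `⟨σ₀σ_x⟩`, unknown on `ℤ³`); `bulk_le_pow_five` (`bulk ≤ C₅L⁵`, infrared
  bound + shell count); `lhs_window`: `a/((K+1)√L) ≤ lhs K L/√bulk L ≤ C₀·L` for `K, L ≥ 1`.
* **C. The exponent ladder `lhs ≤ A·(bulk)^q`** (`bbs_iff_bbsPow_half`: the crux is `q = 1/2`; `bbsPow_mono`):
  `not_bbsPow_of_lt_two_fifths` — **FALSE for every `q < 2/5`**; `bbsPow_of_ge_three_quarters` — **TRUE (proved) for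
  every `q ≥ 3/4`**; the open window is `q ∈ [2/5, 3/4)` and scaling theory (`lhs ≍ L^{3-Δσ}`, `bulk ≍ L^{6-2Δσ}`) puts
  the truth threshold exactly at the crux's `q = 1/2`: the square root is the sharp normalisation.
* **D. The refuter's goal.** `not_bbs_iff` : `¬BBS ↔ ∀ K ≥ 2, ∀ A, ∃ L ≥ 1, A·√bulk L < lhs K L`.
-/

noncomputable section

namespace Summit.CriticalPhenomena.Ising3DConformalLimit.Cruxes.BoundedBoundarySignal.Disproof

open Literature.Probability.LatticeModels Finset
open Summit.CriticalPhenomena.Ising3DConformalLimit.Theses.PersistenceSpeed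
open Summit.CriticalPhenomena.Ising3DConformalLimit.Theses.ArmHyperscaling (OneArmHyperscaling)

/-- The boundary signal `Σ_{x ∈ Λ_L} ⟨σ_x⟩⁺_{Λ_{KL};β_c,0}`. [folklore] -/
def lhs (K L : ℕ) : ℝ :=
  ∑ x ∈ box 3 L, isingCorr (zdGraph 3) (box 3 (K * L)) (criticalBeta 3) 0 BoundaryCondition.plus
    ({x} : Finset (Site 3))

/-- The bulk variance sum `Σ_{x,y ∈ Λ_L} ⟨σ₀σ_{x-y}⟩⁺_{β_c}`. [folklore] -/
def bulk (L : ℕ) : ℝ :=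
  ∑ x ∈ box 3 L, ∑ y ∈ box 3 L, criticalTwoPoint 3 (x - y)

/-- The shorthands are the route decl verbatim. [folklore] -/
theorem bbs_iff : BoundedBoundarySignal ↔
    ∃ K : ℕ, 2 ≤ K ∧ ∃ A : ℝ, ∀ L : ℕ, 1 ≤ L → lhs K L ≤ A * Real.sqrt (bulk L) := Iff.rfl

/-! ## No junk: positivity and size of the two sides -/

/-- `criticalTwoPoint_three_nonneg` (bookkeeping for the BBS dictionary). [folklore] -/
theorem criticalTwoPoint_three_nonneg (z : Site 3) : 0 ≤ criticalTwoPoint 3 z :=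
  (criticalTwoPoint_pos_of_three_le (d := 3) le_rfl z).le

/-- `criticalTwoPoint_three_zero` (bookkeeping for the BBS dictionary). [folklore] -/
theorem criticalTwoPoint_three_zero : criticalTwoPoint 3 0 = 1 := by
  rw [criticalTwoPoint, twoPointPlus_origin]

/-- `one_le_bulk` (bookkeeping for the BBS dictionary). [folklore] -/
theorem one_le_bulk (L : ℕ) : 1 ≤ bulk L := by
  have h0 : (0 : Site 3) ∈ box 3 L := zero_mem_box 3 L
  calc (1 : ℝ) = criticalTwoPoint 3 ((0 : Site 3) - 0) := by
        rw [sub_zero, criticalTwoPoint_three_zero]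
    _ ≤ ∑ y ∈ box 3 L, criticalTwoPoint 3 ((0 : Site 3) - y) :=
        Finset.single_le_sum (f := fun y => criticalTwoPoint 3 ((0 : Site 3) - y))
          (fun y _ => criticalTwoPoint_three_nonneg _) h0
    _ ≤ bulk L :=
        Finset.single_le_sum (f := fun x => ∑ y ∈ box 3 L, criticalTwoPoint 3 (x - y))
          (fun x _ => Finset.sum_nonneg fun y _ => criticalTwoPoint_three_nonneg _) h0

/-- `bulk_pos` (bookkeeping for the BBS dictionary). [folklore] -/
theorem bulk_pos (L : ℕ) : 0 < bulk L := lt_of_lt_of_le one_pos (one_le_bulk L)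

/-- `one_le_sqrt_bulk` (bookkeeping for the BBS dictionary). [folklore] -/
theorem one_le_sqrt_bulk (L : ℕ) : 1 ≤ Real.sqrt (bulk L) := by
  rw [show (1 : ℝ) = Real.sqrt 1 by simp]
  exact Real.sqrt_le_sqrt (one_le_bulk L)

/-- `sqrt_bulk_pos` (bookkeeping for the BBS dictionary). [folklore] -/
theorem sqrt_bulk_pos (L : ℕ) : 0 < Real.sqrt (bulk L) := lt_of_lt_of_le one_pos (one_le_sqrt_bulk L)

/-- GKS I: the boundary signal is nonnegative (for `K ≥ 1`, so that the inner block lies in the volume). [folklore] -/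
theorem lhs_nonneg {K : ℕ} (hK : 1 ≤ K) (L : ℕ) : 0 ≤ lhs K L := by
  refine Finset.sum_nonneg fun x hx => ?_
  have hsub : ({x} : Finset (Site 3)) ⊆ box 3 (K * L) :=
    Finset.singleton_subset_iff.2 (box_mono 3 (Nat.le_mul_of_pos_left L hK) hx)
  exact GKSInequalities.gks_one_holds (G := zdGraph 3) (criticalBeta_nonneg 3) le_rfl (Or.inr rfl) hsub

/-- `Σ_{x∈Λ_L} ⟨σ_x⟩ ≤ |Λ_L|`. [folklore] -/
theorem lhs_le_card (K L : ℕ) : lhs K L ≤ #(box 3 L) := by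
  calc lhs K L ≤ ∑ _x ∈ box 3 L, (1 : ℝ) :=
        Finset.sum_le_sum fun x _ => (abs_le.mp (abs_isingCorr_le_one _ _ _ _ _ _)).2
    _ = #(box 3 L) := by simp

/-- Re-indexing: for `x ∈ Λ_L`, `Σ_{y∈Λ_L} ⟨σ₀σ_{x-y}⟩ ≤ Σ_{z∈Λ_{2L}} ⟨σ₀σ_z⟩` (`y ↦ x - y` is injective with
values in `Λ_{2L}`, summands `≥ 0`). [folklore] -/
theorem sum_box_sub_le {L : ℕ} {x : Site 3} (hx : x ∈ box 3 L) :
    ∑ y ∈ box 3 L, criticalTwoPoint 3 (x - y) ≤ ∑ z ∈ box 3 (2 * L), criticalTwoPoint 3 z := by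
  have hinj : Set.InjOn (fun y : Site 3 => x - y) ↑(box 3 L) := fun y _ y' _ h => sub_right_injective h
  rw [← Finset.sum_image hinj]
  refine Finset.sum_le_sum_of_subset_of_nonneg ?_ fun z _ _ => criticalTwoPoint_three_nonneg z
  intro z hz
  rw [Finset.mem_image] at hz
  obtain ⟨y, hy, rfl⟩ := hz
  rw [mem_box] at hx hy ⊢
  intro i
  have h1 := hx i
  have h2 := hy i
  simp only [Pi.sub_apply]
  push_cast
  omega

private theorem supNorm_single_one : Site.supNorm (Pi.single 0 (1 : ℤ) : Site 3) = 1 := by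
  apply le_antisymm
  · rw [Site.supNorm_le_iff]
    intro j
    by_cases hj : j = 0
    · subst hj; simp
    · rw [Pi.single_eq_of_ne hj]; simp
  · have := Site.natAbs_le_supNorm (Pi.single 0 (1 : ℤ) : Site 3) 0
    simpa using this

/-- **Box sum of the critical two-point function**: `Σ_{z∈Λ_R} ⟨σ₀σ_z⟩_{β_c} ≤ 1 + C·R²` (infrared bound
`⟨σ₀σ_z⟩ ≤ C‖z‖⁻¹`, `criticalTwoPoint_bounds_holds`, and the shell count `sum_box_erase_norm_rpow_le`). [folklore] -/
theorem sum_box_criticalTwoPoint_le : ∃ C : ℝ, 0 < C ∧ ∀ R : ℕ,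
    ∑ z ∈ box 3 R, criticalTwoPoint 3 z ≤ 1 + C * (R : ℝ) ^ 2 := by
  obtain ⟨c, C, hc, h⟩ := criticalTwoPoint_bounds_holds (d := 3) le_rfl
  refine ⟨54 * max C 0 + 1, by positivity, fun R => ?_⟩
  rw [← Finset.add_sum_erase _ _ (zero_mem_box 3 R), criticalTwoPoint_three_zero]
  have hle : ∀ z ∈ (box 3 R).erase 0, criticalTwoPoint 3 z ≤ max C 0 * ‖z‖ ^ (-(1 : ℝ)) := by
    intro z hz
    have hz0 : z ≠ 0 := (Finset.mem_erase.1 hz).1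
    have h2 := (h z hz0).2
    have e : (-(((3 : ℕ) : ℝ) - 2)) = (-1 : ℝ) := by norm_num
    rw [e] at h2
    exact h2.trans (mul_le_mul_of_nonneg_right (le_max_left _ _) (Real.rpow_nonneg (norm_nonneg _) _))
  have hshell := sum_box_erase_norm_rpow_le 1 R
  have hsum : ∑ m ∈ Finset.range R, ((m : ℝ) + 1) ^ (2 - (1 : ℝ)) ≤ (R : ℝ) ^ 2 := by
    have h1 : ∀ m ∈ Finset.range R, ((m : ℝ) + 1) ^ (2 - (1 : ℝ)) ≤ (R : ℝ) := by
      intro m hm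
      rw [show (2 : ℝ) - 1 = 1 by norm_num, Real.rpow_one]
      have := Finset.mem_range.1 hm
      exact_mod_cast this
    calc ∑ m ∈ Finset.range R, ((m : ℝ) + 1) ^ (2 - (1 : ℝ)) ≤ ∑ _m ∈ Finset.range R, (R : ℝ) :=
          Finset.sum_le_sum h1
      _ = (R : ℝ) ^ 2 := by rw [Finset.sum_const, Finset.card_range, nsmul_eq_mul]; ring
  calc 1 + ∑ z ∈ (box 3 R).erase 0, criticalTwoPoint 3 z
        ≤ 1 + ∑ z ∈ (box 3 R).erase 0, max C 0 * ‖z‖ ^ (-(1 : ℝ)) := by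
          gcongr with z hz; exact hle z hz
    _ = 1 + max C 0 * ∑ z ∈ (box 3 R).erase 0, ‖z‖ ^ (-(1 : ℝ)) := by rw [Finset.mul_sum]
    _ ≤ 1 + max C 0 * (54 * (R : ℝ) ^ 2) := by
          gcongr
          exact hshell.trans (by nlinarith [hsum])
    _ ≤ 1 + (54 * max C 0 + 1) * (R : ℝ) ^ 2 := by nlinarith [sq_nonneg (R : ℝ)]

/-- **`bulk L ≤ C₅·L⁵`** for `L ≥ 1` (re-indexing + the box sum bound): the bulk variance sum is at most
`|Λ_L|·(1 + 4C·L²)`, i.e. `sd_L ≲ L^{5/2}` — the `Δσ ≥ 1/2` edge of the rigorous window. [folklore] -/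
theorem bulk_le_pow_five : ∃ C₅ : ℝ, 0 < C₅ ∧ ∀ L : ℕ, 1 ≤ L → bulk L ≤ C₅ * (L : ℝ) ^ 5 := by
  obtain ⟨C, hC, h⟩ := sum_box_criticalTwoPoint_le
  refine ⟨27 * (1 + 4 * C), by positivity, fun L hL => ?_⟩
  have hL1 : (1 : ℝ) ≤ L := by exact_mod_cast hL
  have h1 : bulk L ≤ #(box 3 L) * (1 + C * ((2 * L : ℕ) : ℝ) ^ 2) := by
    calc bulk L ≤ ∑ _x ∈ box 3 L, ∑ z ∈ box 3 (2 * L), criticalTwoPoint 3 z :=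
          Finset.sum_le_sum fun x hx => sum_box_sub_le hx
      _ ≤ ∑ _x ∈ box 3 L, (1 + C * ((2 * L : ℕ) : ℝ) ^ 2) := Finset.sum_le_sum fun x _ => h (2 * L)
      _ = #(box 3 L) * (1 + C * ((2 * L : ℕ) : ℝ) ^ 2) := by rw [Finset.sum_const, nsmul_eq_mul]
  have hcard : (#(box 3 L) : ℝ) ≤ 27 * (L : ℝ) ^ 3 := by
    rw [card_box]; push_cast; nlinarith [pow_le_pow_left₀ (by positivity : (0:ℝ) ≤ 2 * L + 1) (by linarith : (2 : ℝ) * L + 1 ≤ 3 * L) 3]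
  have h2 : 1 + C * ((2 * L : ℕ) : ℝ) ^ 2 ≤ (1 + 4 * C) * (L : ℝ) ^ 2 := by push_cast; nlinarith
  calc bulk L ≤ #(box 3 L) * (1 + C * ((2 * L : ℕ) : ℝ) ^ 2) := h1
    _ ≤ (27 * (L : ℝ) ^ 3) * ((1 + 4 * C) * (L : ℝ) ^ 2) := by gcongr
    _ = 27 * (1 + 4 * C) * (L : ℝ) ^ 5 := by ring

/-- `√bulk L ≤ C₆ · L^{5/2}` for `L ≥ 1`. [folklore] -/
theorem sqrt_bulk_le_pow : ∃ C₆ : ℝ, 0 < C₆ ∧ ∀ L : ℕ, 1 ≤ L →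
    Real.sqrt (bulk L) ≤ C₆ * (L : ℝ) ^ (5 / 2 : ℝ) := by
  obtain ⟨C₅, hC₅, h⟩ := bulk_le_pow_five
  refine ⟨Real.sqrt C₅, by positivity, fun L hL => ?_⟩
  have hL0 : (0 : ℝ) ≤ L := Nat.cast_nonneg _
  have h1 := Real.sqrt_le_sqrt (h L hL)
  rw [Real.sqrt_mul hC₅.le] at h1
  refine h1.trans (le_of_eq ?_)
  congr 1
  rw [Real.sqrt_eq_rpow, ← Real.rpow_natCast, ← Real.rpow_mul hL0]
  norm_num

/-! ## A. Quantifier order, the degenerate instance, the sign of the constant, frozen spins -/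

/-- With `A` allowed to depend on `L` the inequality is empty of content. [folklore] -/
theorem swapped_trivial (K L : ℕ) : ∃ A : ℝ, lhs K L ≤ A * Real.sqrt (bulk L) :=
  ⟨|lhs K L|, (le_abs_self _).trans (le_mul_of_one_le_right (abs_nonneg _) (one_le_sqrt_bulk L))⟩

/-- The excluded instance `L = 0` holds for every aspect ratio and every `A ≥ 1`
(`|Λ_0| = 1`, `|⟨σ₀⟩| ≤ 1 ≤ √bulk 0`). [folklore] -/
theorem at_zero (K : ℕ) {A : ℝ} (hA : 1 ≤ A) : lhs K 0 ≤ A * Real.sqrt (bulk 0) := by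
  have h1 : lhs K 0 ≤ 1 := by simpa [card_box] using lhs_le_card K 0
  have h2 : (1 : ℝ) ≤ A * Real.sqrt (bulk 0) := one_le_mul_of_one_le_of_one_le hA (one_le_sqrt_bulk 0)
  linarith

/-- Every witness constant is nonnegative. [folklore] -/
theorem witness_nonneg {K : ℕ} {A : ℝ} (hK : 1 ≤ K)
    (h : ∀ L : ℕ, 1 ≤ L → lhs K L ≤ A * Real.sqrt (bulk L)) : 0 ≤ A := by
  by_contra hA
  push Not at hA
  have h1 := h 1 le_rfl
  have hneg : A * Real.sqrt (bulk 1) < 0 := mul_neg_of_neg_of_pos hA (sqrt_bulk_pos 1)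
  have := lhs_nonneg hK 1
  linarith

/-- Frozen outside spins: for `x ∉ Λ`, `⟨σ_x⟩⁺_{Λ;β,h} = 1` (the `+` boundary condition fixes `σ_x = 1`). [folklore] -/
theorem isingCorr_plus_singleton_of_not_mem {Λ : Finset (Site 3)} {x : Site 3} (hx : x ∉ Λ) (β h : ℝ) :
    isingCorr (zdGraph 3) Λ β h BoundaryCondition.plus ({x} : Finset (Site 3)) = 1 := by
  rw [isingCorr, isingExpect, integral_isingMeasure (zdGraph 3) Λ β h _ (measurable_spinProduct _)]
  have hsp : ∀ τ : ↥Λ → ℤˣ, spinProduct ({x} : Finset (Site 3)) (glue Λ τ BoundaryCondition.plus) = 1 := by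
    intro τ
    have hg : glue Λ τ BoundaryCondition.plus x = 1 := by
      rw [glue_apply_of_notMem _ _ _ hx]; rfl
    simp [spinProduct, spinAt, hg]
  simp_rw [hsp, mul_one]
  exact div_self (isingPartitionFunction_pos _ _ _ _ _).ne'

/-! ## A. GKS volume antitonicity -/

/-- `lhs_anti` (bookkeeping for the BBS dictionary). [folklore] -/
theorem lhs_anti {K K' : ℕ} (hK : 1 ≤ K) (hKK' : K ≤ K') (L : ℕ) : lhs K' L ≤ lhs K L := by
  refine Finset.sum_le_sum fun x hx => ?_
  have hsub : ({x} : Finset (Site 3)) ⊆ box 3 (K * L) :=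
    Finset.singleton_subset_iff.2 (box_mono 3 (Nat.le_mul_of_pos_left L hK) hx)
  have h12 : box 3 (K * L) ⊆ box 3 (K' * L) := box_mono 3 (Nat.mul_le_mul_right L hKK')
  exact isingCorr_plus_le_of_subset (G := zdGraph 3) (criticalBeta_nonneg 3) le_rfl hsub h12

/-- The `K`-slice is monotone in `K`: a larger collar only weakens the boundary signal. [folklore] -/
theorem slice_mono {K K' : ℕ} {A : ℝ} (hK : 1 ≤ K) (hKK' : K ≤ K')
    (h : ∀ L : ℕ, 1 ≤ L → lhs K L ≤ A * Real.sqrt (bulk L)) :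
    ∀ L : ℕ, 1 ≤ L → lhs K' L ≤ A * Real.sqrt (bulk L) :=
  fun L hL => (lhs_anti hK hKK' L).trans (h L hL)

/-- BBS ↔ arbitrarily large aspect ratios work (with the same constant). [folklore] -/
theorem bbs_iff_cofinal : BoundedBoundarySignal ↔
    ∀ K₀ : ℕ, ∃ K : ℕ, K₀ ≤ K ∧ 2 ≤ K ∧ ∃ A : ℝ, ∀ L : ℕ, 1 ≤ L → lhs K L ≤ A * Real.sqrt (bulk L) := by
  constructor
  · rintro ⟨K, hK, A, h⟩ K₀
    exact ⟨max K K₀, le_max_right _ _, hK.trans (le_max_left _ _), A,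
      slice_mono (by omega) (le_max_left _ _) h⟩
  · intro h
    obtain ⟨K, -, hK2, A, hA⟩ := h 2
    exact ⟨K, hK2, A, hA⟩

/-! ## A. The one-arm quantity and the translation sandwich -/

/-- `m⁺_R := ⟨σ₀⟩⁺_{Λ_R;β_c(3),0}` (= `plusBoxMag`, the wired FK-Ising one-arm quantity). [folklore] -/
def boxMag (R : ℕ) : ℝ :=
  isingCorr (zdGraph 3) (box 3 R) (criticalBeta 3) 0 BoundaryCondition.plus ({0} : Finset (Site 3))

/-- `boxMag_nonneg` (bookkeeping for the BBS dictionary). [folklore] -/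
theorem boxMag_nonneg (R : ℕ) : 0 ≤ boxMag R :=
  GKSInequalities.gks_one_holds (G := zdGraph 3) (criticalBeta_nonneg 3) le_rfl (Or.inr rfl)
    (Finset.singleton_subset_iff.2 (zero_mem_box 3 R))

/-- `boxMag_le_one` (bookkeeping for the BBS dictionary). [folklore] -/
theorem boxMag_le_one (R : ℕ) : boxMag R ≤ 1 :=
  (abs_le.1 (abs_isingCorr_le_one (zdGraph 3) (box 3 R) (criticalBeta 3) 0 .plus {0})).2

/-- `R ↦ m⁺_R` is non-increasing (GKS volume antitonicity). [folklore] -/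
theorem boxMag_antitone {R R' : ℕ} (h : R ≤ R') : boxMag R' ≤ boxMag R :=
  isingCorr_plus_le_of_subset (G := zdGraph 3) (criticalBeta_nonneg 3) le_rfl
    (Finset.singleton_subset_iff.2 (zero_mem_box 3 R)) (box_mono 3 h)

/-- `map_singleton_zero` (bookkeeping for the BBS dictionary). [folklore] -/
private theorem map_singleton_zero (x : Site 3) :
    ({0} : Finset (Site 3)).map (Site.shift x).toEmbedding = {x} := by
  rw [Finset.map_singleton]
  simp

/-- Pointwise upper half: for `x ∈ Λ_L` and `M + L ≤ R`, `⟨σ_x⟩⁺_{Λ_R} ≤ m⁺_M`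
(`x + Λ_M ⊆ Λ_R`, GKS volume antitonicity, translation). [folklore] -/
theorem corr_le_boxMag {L M R : ℕ} {x : Site 3} (hx : x ∈ box 3 L) (hMR : M + L ≤ R) :
    isingCorr (zdGraph 3) (box 3 R) (criticalBeta 3) 0 BoundaryCondition.plus ({x} : Finset (Site 3))
      ≤ boxMag M := by
  have hxn : Site.supNorm x ≤ L := mem_box_iff_supNorm_le.1 hx
  have h1 : (box 3 M).map (Site.shift x).toEmbedding ⊆ box 3 R :=
    (map_shift_box_subset M x).trans (box_mono 3 (by omega))
  have hA : ({0} : Finset (Site 3)).map (Site.shift x).toEmbedding ⊆ (box 3 M).map (Site.shift x).toEmbedding :=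
    Finset.map_subset_map.2 (Finset.singleton_subset_iff.2 (zero_mem_box 3 M))
  rw [← map_singleton_zero x]
  calc isingCorr (zdGraph 3) (box 3 R) (criticalBeta 3) 0 BoundaryCondition.plus
          (({0} : Finset (Site 3)).map (Site.shift x).toEmbedding)
        ≤ isingCorr (zdGraph 3) ((box 3 M).map (Site.shift x).toEmbedding) (criticalBeta 3) 0 .plus
          (({0} : Finset (Site 3)).map (Site.shift x).toEmbedding) :=
        isingCorr_plus_le_of_subset (G := zdGraph 3) (criticalBeta_nonneg 3) le_rfl hA h1
    _ = boxMag M := isingCorr_plus_map_shift x (box 3 M) {0} _ _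

/-- Pointwise lower half: for `x ∈ Λ_L ⊆ Λ_R` and `R + L ≤ R'`, `m⁺_{R'} ≤ ⟨σ_x⟩⁺_{Λ_R}`
(`Λ_R ⊆ x + Λ_{R'}`). [folklore] -/
theorem boxMag_le_corr {L R R' : ℕ} {x : Site 3} (hx : x ∈ box 3 L) (hLR : L ≤ R) (hR' : R + L ≤ R') :
    boxMag R' ≤
      isingCorr (zdGraph 3) (box 3 R) (criticalBeta 3) 0 BoundaryCondition.plus ({x} : Finset (Site 3)) := by
  have hxn : Site.supNorm x ≤ L := mem_box_iff_supNorm_le.1 hx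
  have hA : ({x} : Finset (Site 3)) ⊆ box 3 R := Finset.singleton_subset_iff.2 (box_mono 3 hLR hx)
  have h12 : box 3 R ⊆ (box 3 R').map (Site.shift x).toEmbedding :=
    (box_subset_map_shift_box R x).trans (Finset.map_subset_map.2 (box_mono 3 (by omega)))
  have key := isingCorr_plus_le_of_subset (G := zdGraph 3) (criticalBeta_nonneg 3) le_rfl hA h12
  rw [← map_singleton_zero x, isingCorr_plus_map_shift x (box 3 R') {0}] at key
  rwa [← map_singleton_zero x]

/-- **Upper half of the sandwich** (= the birth line's `stub_plusSumLe`): `lhs K L ≤ |Λ_L| · m⁺_M` whenever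
`M + L ≤ K L` (e.g. `M = (K-1)L`). [folklore] -/
theorem lhs_le_card_mul_boxMag {K L M : ℕ} (hM : M + L ≤ K * L) : lhs K L ≤ #(box 3 L) * boxMag M := by
  calc lhs K L ≤ ∑ _x ∈ box 3 L, boxMag M := Finset.sum_le_sum fun x hx => corr_le_boxMag hx hM
    _ = #(box 3 L) * boxMag M := by rw [Finset.sum_const, nsmul_eq_mul]

/-- **Lower half of the sandwich**: `|Λ_L| · m⁺_{R'} ≤ lhs K L` whenever `K ≥ 1` and `K L + L ≤ R'`. [folklore] -/
theorem card_mul_boxMag_le_lhs {K L R' : ℕ} (hK : 1 ≤ K) (hR' : K * L + L ≤ R') :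
    #(box 3 L) * boxMag R' ≤ lhs K L := by
  have hLR : L ≤ K * L := by nlinarith
  calc (#(box 3 L) : ℝ) * boxMag R' = ∑ _x ∈ box 3 L, boxMag R' := by rw [Finset.sum_const, nsmul_eq_mul]
    _ ≤ lhs K L := Finset.sum_le_sum fun x hx => boxMag_le_corr hx hLR hR'

/-! ## A. Reformulation: one-arm hyperscaling against the box-averaged two-point function -/

/-- `slice_succ_of_avgOneArm` (bookkeeping for the BBS dictionary). [folklore] -/
theorem slice_succ_of_avgOneArm {K : ℕ} {A : ℝ}
    (h : ∀ L : ℕ, 1 ≤ L → (#(box 3 L) : ℝ) * boxMag (K * L) ≤ A * Real.sqrt (bulk L)) :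
    ∀ L : ℕ, 1 ≤ L → lhs (K + 1) L ≤ A * Real.sqrt (bulk L) :=
  fun L hL => (lhs_le_card_mul_boxMag (by rw [Nat.succ_mul])).trans (h L hL)

/-- `avgOneArm_succ_of_slice` (bookkeeping for the BBS dictionary). [folklore] -/
theorem avgOneArm_succ_of_slice {K : ℕ} {A : ℝ} (hK : 1 ≤ K)
    (h : ∀ L : ℕ, 1 ≤ L → lhs K L ≤ A * Real.sqrt (bulk L)) :
    ∀ L : ℕ, 1 ≤ L → (#(box 3 L) : ℝ) * boxMag ((K + 1) * L) ≤ A * Real.sqrt (bulk L) :=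
  fun L hL => (card_mul_boxMag_le_lhs hK (by rw [Nat.succ_mul])).trans (h L hL)

/-- **BBS ⟺ ∃ K ≥ 1, ∃ A, ∀ L ≥ 1, |Λ_L|·⟨σ₀⟩⁺_{Λ_{KL}} ≤ A·(Σ_{x,y∈Λ_L}⟨σ_xσ_y⟩)^{1/2}.** [folklore] -/
theorem bbs_iff_avgOneArm : BoundedBoundarySignal ↔
    ∃ K : ℕ, 1 ≤ K ∧ ∃ A : ℝ, ∀ L : ℕ, 1 ≤ L → (#(box 3 L) : ℝ) * boxMag (K * L) ≤ A * Real.sqrt (bulk L) := by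
  constructor
  · rintro ⟨K, hK, A, h⟩
    exact ⟨K + 1, by omega, A, avgOneArm_succ_of_slice (by omega) h⟩
  · rintro ⟨K, hK, A, h⟩
    exact ⟨K + 1, by omega, A, slice_succ_of_avgOneArm h⟩

/-! ## B. MMS box comparison and OneArmHyperscaling ⇒ BBS -/

/-- `x, y ∈ Λ_L ⇒ 3‖x - y‖_∞ ≤ 6L = ‖6L e₀‖_∞`. [folklore] -/
private theorem three_mul_supNorm_sub_le {L : ℕ} {x y : Site 3} (hx : x ∈ box 3 L) (hy : y ∈ box 3 L) :
    3 * Site.supNorm (x - y) ≤ Site.supNorm (Pi.single 0 (2 * ((3 * L : ℕ) : ℤ)) : Site 3) := by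
  have hxy : x - y ∈ box 3 (2 * L) := by
    rw [mem_box] at hx hy ⊢
    intro i
    have h1 := hx i
    have h2 := hy i
    simp only [Pi.sub_apply]
    push_cast
    omega
  have h3 : Site.supNorm (x - y) ≤ 2 * L := mem_box_iff_supNorm_le.1 hxy
  have h4 : 6 * L ≤ Site.supNorm (Pi.single 0 (2 * ((3 * L : ℕ) : ℤ)) : Site 3) := by
    have := Site.natAbs_le_supNorm (Pi.single 0 (2 * ((3 * L : ℕ) : ℤ)) : Site 3) 0
    simp only [Pi.single_eq_same] at this
    omega
  omega

/-- **MMS box comparison** (= the birth line's `stub_boxSumGe`):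
`|Λ_L|² · ⟨σ₀σ_{6Le₀}⟩_{β_c} ≤ Σ_{x,y∈Λ_L} ⟨σ₀σ_{x-y}⟩_{β_c}` (sup-norm Messager–Miracle-Solé,
Aizenman–Duminil-Copin 2021 (5.3): `‖y‖_∞ ≥ 3‖x‖_∞ ⇒ S(y) ≤ S(x)`). [folklore] -/
theorem card_sq_mul_axis_le_bulk (L : ℕ) :
    (#(box 3 L) : ℝ) ^ 2 * criticalTwoPoint 3 (Pi.single 0 (2 * ((3 * L : ℕ) : ℤ))) ≤ bulk L := by
  calc (#(box 3 L) : ℝ) ^ 2 * criticalTwoPoint 3 (Pi.single 0 (2 * ((3 * L : ℕ) : ℤ)))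
        = ∑ _x ∈ box 3 L, ∑ _y ∈ box 3 L, criticalTwoPoint 3 (Pi.single 0 (2 * ((3 * L : ℕ) : ℤ))) := by
          rw [Finset.sum_const, nsmul_eq_mul, Finset.sum_const, nsmul_eq_mul]; ring
    _ ≤ bulk L := Finset.sum_le_sum fun x hx => Finset.sum_le_sum fun y hy =>
          twoPointPlus_le_of_mul_supNorm_le (d := 3) (criticalBeta_nonneg 3) (three_mul_supNorm_sub_le hx hy)

/-- The birth line's `stub_boxSumGe`, verbatim shape. [folklore] -/
theorem stub_boxSumGe (L : ℕ) (_hL : 1 ≤ L) :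
    ((box 3 L).card : ℝ) ^ 2 * criticalTwoPoint 3 (Pi.single 0 (2 * ((3 * L : ℕ) : ℤ))) ≤
        ∑ x ∈ box 3 L, ∑ y ∈ box 3 L, criticalTwoPoint 3 (x - y) ∧
      0 ≤ criticalTwoPoint 3 (Pi.single 0 (2 * ((3 * L : ℕ) : ℤ))) :=
  ⟨card_sq_mul_axis_le_bulk L, criticalTwoPoint_three_nonneg _⟩

/-- `⟨σ₀σ_{2ne₀}⟩_{β_c(3)}`, the right-hand side of `OneArmHyperscaling`. [folklore] -/
def axisTwoPoint (n : ℕ) : ℝ := criticalTwoPoint 3 (Pi.single 0 (2 * (n : ℤ)))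

/-- `OneArmHyperscaling` (stmt-15591) in this vocabulary (definitional). [folklore] -/
theorem oneArmHyperscaling_iff :
    OneArmHyperscaling ↔ ∃ K : ℕ, 1 ≤ K ∧ ∃ C : ℝ, ∀ n : ℕ, 1 ≤ n → boxMag (K * n) ^ 2 ≤ C * axisTwoPoint n :=
  Iff.rfl

/-- `supNorm_single_nat` (bookkeeping for the BBS dictionary). [folklore] -/
private theorem supNorm_single_nat (m : ℕ) : Site.supNorm (Pi.single 0 (m : ℤ) : Site 3) = m := by
  apply le_antisymm
  · rw [Site.supNorm_le_iff]
    intro j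
    by_cases hj : j = 0
    · subst hj; simp
    · rw [Pi.single_eq_of_ne hj]; simp
  · have := Site.natAbs_le_supNorm (Pi.single 0 (m : ℤ) : Site 3) 0
    simpa using this

/-- `single_nat_ne_zero` (bookkeeping for the BBS dictionary). [folklore] -/
private theorem single_nat_ne_zero {m : ℕ} (hm : 1 ≤ m) : (Pi.single 0 (m : ℤ) : Site 3) ≠ 0 := by
  intro h
  have := congrFun h 0
  simp at this
  omega

/-- Simon–Lieb lower bound along the axis: `c/m² ≤ ⟨σ₀σ_{me₀}⟩_{β_c(3)}` for `m ≥ 1`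
(`criticalTwoPoint_bounds_holds`). [folklore] -/
theorem axis_lower : ∃ c : ℝ, 0 < c ∧ ∀ m : ℕ, 1 ≤ m →
    c / (m : ℝ) ^ 2 ≤ criticalTwoPoint 3 (Pi.single 0 (m : ℤ)) := by
  obtain ⟨c, C, hc, h⟩ := criticalTwoPoint_bounds_holds (d := 3) le_rfl
  refine ⟨c, hc, fun m hm => ?_⟩
  have h1 := (h _ (single_nat_ne_zero hm)).1
  rw [Site.norm_eq_supNorm, supNorm_single_nat] at h1
  have hm0 : (0 : ℝ) < m := by exact_mod_cast hm
  have : (m : ℝ) ^ (-((3 : ℕ) - 1 : ℝ)) = ((m : ℝ) ^ 2)⁻¹ := by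
    rw [Real.rpow_neg hm0.le, show ((3 : ℕ) - 1 : ℝ) = (2 : ℕ) by norm_num, Real.rpow_natCast]
  rw [this, ← div_eq_mul_inv] at h1
  exact h1

/-- `c/(4n²) ≤ ⟨σ₀σ_{2ne₀}⟩` for `n ≥ 1`. [folklore] -/
theorem le_axisTwoPoint : ∃ c : ℝ, 0 < c ∧ ∀ n : ℕ, 1 ≤ n → c / (n : ℝ) ^ 2 ≤ axisTwoPoint n := by
  obtain ⟨c, hc, h⟩ := axis_lower
  refine ⟨c / 4, by positivity, fun n hn => ?_⟩
  have h1 := h (2 * n) (by omega)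
  have : (Pi.single 0 (((2 * n : ℕ) : ℤ)) : Site 3) = Pi.single 0 (2 * (n : ℤ)) := by push_cast; rfl
  rw [this] at h1
  calc c / 4 / (n : ℝ) ^ 2 = c / (((2 * n : ℕ) : ℝ)) ^ 2 := by push_cast; ring
    _ ≤ axisTwoPoint n := h1

/-- `axisTwoPoint_pos` (bookkeeping for the BBS dictionary). [folklore] -/
theorem axisTwoPoint_pos {n : ℕ} (hn : 1 ≤ n) : 0 < axisTwoPoint n := by
  obtain ⟨c, hc, h⟩ := le_axisTwoPoint
  have hn0 : (0 : ℝ) < n := by exact_mod_cast hn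
  exact lt_of_lt_of_le (by positivity) (h n hn)

/-- Tasaki's converse at box scale (landed GKS decoupling `twoPointPlus_le_isingCorr_plus_box_sq`):
`⟨σ₀σ_{(2R+2)e₀}⟩_{β_c} ≤ (m⁺_R)²`. [folklore] -/
theorem axis_far_le_boxMag_sq (R : ℕ) :
    criticalTwoPoint 3 (Pi.single 0 ((2 * R + 2 : ℕ) : ℤ)) ≤ boxMag R ^ 2 :=
  AnomalousForcesInteractionEtaPositive.twoPointPlus_le_isingCorr_plus_box_sq (d := 3)
    (criticalBeta_nonneg 3) (by rw [supNorm_single_nat])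

/-- **One-arm lower bound** `m⁺_R ≥ a/R` (`R ≥ 1`; Tasaki + Simon–Lieb). [folklore] -/
theorem boxMag_lower : ∃ a : ℝ, 0 < a ∧ ∀ R : ℕ, 1 ≤ R → a / R ≤ boxMag R := by
  obtain ⟨c, hc, h⟩ := axis_lower
  refine ⟨Real.sqrt c / 4, by positivity, fun R hR => ?_⟩
  have hR1 : (1 : ℝ) ≤ R := by exact_mod_cast hR
  have h1 := (h (2 * R + 2) (by omega)).trans (axis_far_le_boxMag_sq R)
  have h2 := Real.sqrt_le_sqrt h1
  rw [Real.sqrt_sq (boxMag_nonneg R), Real.sqrt_div' _ (by positivity),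
    Real.sqrt_sq (by positivity)] at h2
  calc Real.sqrt c / 4 / R = Real.sqrt c / (4 * R) := by rw [div_div]
    _ ≤ Real.sqrt c / ((2 * R + 2 : ℕ) : ℝ) := by
        apply div_le_div_of_nonneg_left (Real.sqrt_nonneg c) (by positivity)
        push_cast; linarith
    _ ≤ boxMag R := h2

/-- One-arm hyperscaling at aspect ratio `K` gives the averaged one-arm bound at aspect ratio `3K`. [folklore] -/
theorem avgOneArm_of_oneArmHyperscalingAt {K : ℕ} {C : ℝ}
    (hC : ∀ n : ℕ, 1 ≤ n → boxMag (K * n) ^ 2 ≤ C * axisTwoPoint n) :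
    ∃ A : ℝ, ∀ L : ℕ, 1 ≤ L → (#(box 3 L) : ℝ) * boxMag (3 * K * L) ≤ A * Real.sqrt (bulk L) := by
  refine ⟨Real.sqrt (max C 0), fun L hL => ?_⟩
  have h1 := hC (3 * L) (by omega)
  have hmul : K * (3 * L) = 3 * K * L := by ring
  rw [hmul] at h1
  have h2 := card_sq_mul_axis_le_bulk L
  have hax : axisTwoPoint (3 * L) = criticalTwoPoint 3 (Pi.single 0 (2 * ((3 * L : ℕ) : ℤ))) := rfl
  rw [← hax] at h2
  have hGnn : 0 ≤ axisTwoPoint (3 * L) := (axisTwoPoint_pos (by omega)).le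
  have hcard : (0 : ℝ) ≤ #(box 3 L) := Nat.cast_nonneg _
  have hm : 0 ≤ boxMag (3 * K * L) := boxMag_nonneg _
  rw [← Real.sqrt_mul (le_max_right _ _),
    Real.le_sqrt (mul_nonneg hcard hm) (mul_nonneg (le_max_right _ _) (bulk_pos L).le)]
  calc ((#(box 3 L) : ℝ) * boxMag (3 * K * L)) ^ 2 = (#(box 3 L) : ℝ) ^ 2 * boxMag (3 * K * L) ^ 2 := by ring
    _ ≤ (#(box 3 L) : ℝ) ^ 2 * (max C 0 * axisTwoPoint (3 * L)) := by
        gcongr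
        exact h1.trans (mul_le_mul_of_nonneg_right (le_max_left _ _) hGnn)
    _ = max C 0 * ((#(box 3 L) : ℝ) ^ 2 * axisTwoPoint (3 * L)) := by ring
    _ ≤ max C 0 * bulk L := mul_le_mul_of_nonneg_left h2 (le_max_right _ _)

/-- **`OneArmHyperscaling` (crux stmt-CriticalPhenomena-15591 of route ArmHyperscaling) implies
`BoundedBoundarySignal`** — the birth line of BBS, fully composed and sorry-free. -/
theorem bbs_of_oneArmHyperscaling (h : OneArmHyperscaling) : BoundedBoundarySignal := by
  obtain ⟨K, hK, C, hC⟩ := oneArmHyperscaling_iff.1 h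
  obtain ⟨A, hA⟩ := avgOneArm_of_oneArmHyperscalingAt hC
  exact bbs_iff_avgOneArm.2 ⟨3 * K, by omega, A, hA⟩

/-! ## B. The rigorous window for the ratio lhs K L / √bulk L -/

/-- Upper edge: `lhs K L ≤ C₀ · L · √bulk L` for all `K` and `L ≥ 1` (`|⟨σ_x⟩| ≤ 1` and the Simon–Lieb
lower bound `⟨σ₀σ_{6Le₀}⟩ ≥ c/L²` through the MMS box comparison). [folklore] -/
theorem lhs_le_mul_sqrt_bulk : ∃ C₀ : ℝ, 0 < C₀ ∧ ∀ K L : ℕ, 1 ≤ L → lhs K L ≤ C₀ * L * Real.sqrt (bulk L) := by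
  obtain ⟨c, hc, hG⟩ := le_axisTwoPoint
  refine ⟨3 / Real.sqrt c, by positivity, fun K L hL => ?_⟩
  have hL0 : (0 : ℝ) < L := by exact_mod_cast hL
  have h1 := hG (3 * L) (by omega)
  have h2 := card_sq_mul_axis_le_bulk L
  have hax : axisTwoPoint (3 * L) = criticalTwoPoint 3 (Pi.single 0 (2 * ((3 * L : ℕ) : ℤ))) := rfl
  rw [← hax] at h2
  -- `|Λ_L| · √c/(3L) ≤ √bulk`
  have hcard : (0 : ℝ) ≤ #(box 3 L) := Nat.cast_nonneg _
  have h3 : (#(box 3 L) : ℝ) ^ 2 * (c / ((3 * L : ℕ) : ℝ) ^ 2) ≤ bulk L :=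
    (mul_le_mul_of_nonneg_left h1 (by positivity)).trans h2
  have h4 : (#(box 3 L) : ℝ) * (Real.sqrt c / (3 * L)) ≤ Real.sqrt (bulk L) := by
    rw [Real.le_sqrt (by positivity) (bulk_pos L).le]
    calc ((#(box 3 L) : ℝ) * (Real.sqrt c / (3 * L))) ^ 2
          = (#(box 3 L) : ℝ) ^ 2 * (Real.sqrt c ^ 2 / (3 * L) ^ 2) := by ring
      _ = (#(box 3 L) : ℝ) ^ 2 * (c / ((3 * L : ℕ) : ℝ) ^ 2) := by
          rw [Real.sq_sqrt hc.le]; push_cast; ring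
      _ ≤ bulk L := h3
  calc lhs K L ≤ #(box 3 L) := lhs_le_card K L
    _ = 3 / Real.sqrt c * L * ((#(box 3 L) : ℝ) * (Real.sqrt c / (3 * L))) := by
        field_simp
    _ ≤ 3 / Real.sqrt c * L * Real.sqrt (bulk L) := by gcongr

/-- Quadratic floor of the boundary signal: `a/(K+1) · (2L+1)² ≤ lhs K L` (`K, L ≥ 1`). [folklore] -/
theorem lhs_ge_sq : ∃ a : ℝ, 0 < a ∧ ∀ K L : ℕ, 1 ≤ K → 1 ≤ L →
    a / ((K : ℝ) + 1) * ((2 * L + 1 : ℕ) : ℝ) ^ 2 ≤ lhs K L := by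
  obtain ⟨a, ha, hlow⟩ := boxMag_lower
  refine ⟨a, ha, fun K L hK hL => ?_⟩
  have hKL : 1 ≤ (K + 1) * L := Nat.one_le_iff_ne_zero.2 (Nat.mul_ne_zero (by omega) (by omega))
  have h1 := hlow ((K + 1) * L) hKL
  have h2 := card_mul_boxMag_le_lhs (K := K) (L := L) (R' := (K + 1) * L) hK (by rw [Nat.succ_mul])
  have hcast : (((K + 1) * L : ℕ) : ℝ) = ((K : ℝ) + 1) * L := by push_cast; ring
  rw [hcast] at h1
  have hL1 : (1 : ℝ) ≤ L := by exact_mod_cast hL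
  have hcard : (#(box 3 L) : ℝ) = ((2 * L + 1 : ℕ) : ℝ) ^ 3 := by rw [card_box]; push_cast; ring
  calc a / ((K : ℝ) + 1) * ((2 * L + 1 : ℕ) : ℝ) ^ 2
        ≤ a / ((K : ℝ) + 1) * (((2 * L + 1 : ℕ) : ℝ) ^ 3 / L) := by
          gcongr
          rw [le_div_iff₀ (by positivity)]
          push_cast
          nlinarith
    _ = ((2 * L + 1 : ℕ) : ℝ) ^ 3 * (a / (((K : ℝ) + 1) * L)) := by
          field_simp
    _ ≤ #(box 3 L) * boxMag ((K + 1) * L) := by rw [hcard]; gcongr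
    _ ≤ lhs K L := h2

/-- Lower edge of the window (sharp form): `a/((K+1)√L) · √bulk L ≤ lhs K L` for `K, L ≥ 1` (the quadratic
floor `lhs ≥ a/(K+1)·(2L+1)²` from the sandwich + `m⁺_R ≥ a/R`, against `√bulk ≤ C₆ L^{5/2}` from the
infrared bound). [folklore] -/
theorem mul_sqrt_bulk_le_lhs : ∃ a : ℝ, 0 < a ∧ ∀ K L : ℕ, 1 ≤ K → 1 ≤ L →
    a / (((K : ℝ) + 1) * Real.sqrt L) * Real.sqrt (bulk L) ≤ lhs K L := by
  obtain ⟨a, ha, hlow⟩ := lhs_ge_sq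
  obtain ⟨C₆, hC₆, hup⟩ := sqrt_bulk_le_pow
  refine ⟨a / C₆, by positivity, fun K L hK hL => ?_⟩
  have hL0 : (0 : ℝ) < L := by exact_mod_cast hL
  have h1 := hlow K L hK hL
  have h2 := hup L hL
  have h52 : (L : ℝ) ^ (5 / 2 : ℝ) = (L : ℝ) ^ 2 * Real.sqrt L := by
    rw [Real.sqrt_eq_rpow, ← Real.rpow_natCast, ← Real.rpow_add hL0]; norm_num
  rw [h52] at h2
  have hsq : 0 < Real.sqrt (L : ℝ) := Real.sqrt_pos.2 hL0
  have hK0 : (0 : ℝ) < (K : ℝ) + 1 := by positivity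
  calc a / C₆ / (((K : ℝ) + 1) * Real.sqrt L) * Real.sqrt (bulk L)
        ≤ a / C₆ / (((K : ℝ) + 1) * Real.sqrt L) * (C₆ * ((L : ℝ) ^ 2 * Real.sqrt L)) := by gcongr
    _ = a / ((K : ℝ) + 1) * (L : ℝ) ^ 2 := by field_simp
    _ ≤ a / ((K : ℝ) + 1) * ((2 * L + 1 : ℕ) : ℝ) ^ 2 := by
        have hsq2 : (L : ℝ) ^ 2 ≤ ((2 * L + 1 : ℕ) : ℝ) ^ 2 := by push_cast; nlinarith
        exact mul_le_mul_of_nonneg_left hsq2 (by positivity)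
    _ ≤ lhs K L := h1

/-- **The rigorous window**: `a/((K+1)√L) ≤ lhs K L / √bulk L ≤ C₀ L` for `K, L ≥ 1`; BBS asserts `≤ A`.
Polynomial width `L^{3/2}` with the owned inequalities (GKS, MMS, IRB, Simon–Lieb, Tasaki); no cheap
counterexample can live inside it. [folklore] -/
theorem lhs_window : ∃ a C₀ : ℝ, 0 < a ∧ 0 < C₀ ∧ ∀ K L : ℕ, 1 ≤ K → 1 ≤ L →
    a / (((K : ℝ) + 1) * Real.sqrt L) ≤ lhs K L / Real.sqrt (bulk L) ∧
      lhs K L / Real.sqrt (bulk L) ≤ C₀ * L := by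
  obtain ⟨a, ha, hlow⟩ := mul_sqrt_bulk_le_lhs
  obtain ⟨C₀, hC₀, hup⟩ := lhs_le_mul_sqrt_bulk
  refine ⟨a, C₀, ha, hC₀, fun K L hK hL => ⟨?_, ?_⟩⟩
  · rw [le_div_iff₀ (sqrt_bulk_pos L)]
    exact hlow K L hK hL
  · rw [div_le_iff₀ (sqrt_bulk_pos L)]
    exact hup K L hL

/-! ## C. The exponent ladder lhs ≤ A·(bulk)^q -/

/-- `bbs_iff_bbsPow_half` (bookkeeping for the BBS dictionary). [folklore] -/
theorem bbs_iff_bbsPow_half : BoundedBoundarySignal ↔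
    ∃ K : ℕ, 2 ≤ K ∧ ∃ A : ℝ, ∀ L : ℕ, 1 ≤ L → lhs K L ≤ A * bulk L ^ (1 / 2 : ℝ) := by
  simp only [bbs_iff, Real.sqrt_eq_rpow]

/-- `bbsPow_mono` (bookkeeping for the BBS dictionary). [folklore] -/
theorem bbsPow_mono {p q : ℝ} (hpq : p ≤ q) :
    (∃ K : ℕ, 2 ≤ K ∧ ∃ A : ℝ, ∀ L : ℕ, 1 ≤ L → lhs K L ≤ A * bulk L ^ p) →
      ∃ K : ℕ, 2 ≤ K ∧ ∃ A : ℝ, ∀ L : ℕ, 1 ≤ L → lhs K L ≤ A * bulk L ^ q := by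
  rintro ⟨K, hK, A, h⟩
  refine ⟨K, hK, max A 0, fun L hL => (h L hL).trans ?_⟩
  have h1 : bulk L ^ p ≤ bulk L ^ q := Real.rpow_le_rpow_of_exponent_le (one_le_bulk L) hpq
  calc A * bulk L ^ p ≤ max A 0 * bulk L ^ p :=
        mul_le_mul_of_nonneg_right (le_max_left _ _) (Real.rpow_nonneg (bulk_pos L).le _)
    _ ≤ max A 0 * bulk L ^ q := mul_le_mul_of_nonneg_left h1 (le_max_right _ _)

/-- **Every rung `q < 2/5` is FALSE**: `lhs ≥ a/(K+1)·L²` (sandwich + `m⁺_R ≥ a/R`) against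
`(bulk)^q ≤ (C₅L⁵)^q` (infrared bound).  (Hyperscaling `lhs ≍ L^{3-Δσ}`, `bulk ≍ L^{6-2Δσ}` kills every
`q < 1/2`: the crux's square root is the sharp exponent.) [folklore] -/
theorem not_bbsPow_of_lt_two_fifths {q : ℝ} (hq : q < 2 / 5) :
    ¬ ∃ K : ℕ, 2 ≤ K ∧ ∃ A : ℝ, ∀ L : ℕ, 1 ≤ L → lhs K L ≤ A * bulk L ^ q := by
  rintro ⟨K, hK, A, h⟩
  obtain ⟨a, ha, hlow⟩ := lhs_ge_sq
  obtain ⟨C₅, hC₅, hb⟩ := bulk_le_pow_five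
  set e : ℝ := 5 * max q 0 with he_def
  have he2 : e < 2 := by
    have : max q 0 < 2 / 5 := max_lt hq (by norm_num)
    rw [he_def]; linarith
  have hq0 : 0 ≤ max q 0 := le_max_right _ _
  set B : ℝ := max A 0 * C₅ ^ (max q 0) * ((K : ℝ) + 1) / a with hB_def
  -- Step 1: for every `L ≥ 1`, `L^(2-e) ≤ B`.
  have key : ∀ L : ℕ, 1 ≤ L → ((L : ℝ)) ^ (2 - e) ≤ B := by
    intro L hL
    set t : ℝ := (L : ℝ) with ht_def
    have ht1 : 1 ≤ t := by rw [ht_def]; exact_mod_cast hL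
    have ht0 : 0 < t := by linarith
    have h1 := hlow K L (by omega) hL
    have h2 := h L hL
    have hb1 := one_le_bulk L
    have hb0 := (bulk_pos L).le
    -- `bulk^q ≤ C₅^q⁺ · t^e`
    have h3 : bulk L ^ q ≤ C₅ ^ (max q 0) * t ^ e := by
      calc bulk L ^ q ≤ bulk L ^ (max q 0) := Real.rpow_le_rpow_of_exponent_le hb1 (le_max_left _ _)
        _ ≤ (C₅ * t ^ (5 : ℝ)) ^ (max q 0) := by
            apply Real.rpow_le_rpow hb0 _ hq0
            calc bulk L ≤ C₅ * (L : ℝ) ^ 5 := hb L hL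
              _ = C₅ * t ^ (5 : ℝ) := by
                  rw [ht_def, show (5 : ℝ) = ((5 : ℕ) : ℝ) by norm_num, Real.rpow_natCast]
        _ = C₅ ^ (max q 0) * t ^ e := by
            rw [Real.mul_rpow hC₅.le (Real.rpow_nonneg ht0.le _), ← Real.rpow_mul ht0.le, he_def]
    -- `a/(K+1) · t² ≤ lhs` (from the `(2L+1)²` floor)
    have h1' : a / ((K : ℝ) + 1) * t ^ (2 : ℝ) ≤ lhs K L := by
      have : t ^ (2 : ℝ) = t ^ 2 := by
        rw [show (2 : ℝ) = ((2 : ℕ) : ℝ) by norm_num, Real.rpow_natCast]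
      rw [this]
      refine le_trans ?_ h1
      gcongr
      rw [ht_def]; push_cast; nlinarith
    have h4 : a / ((K : ℝ) + 1) * t ^ (2 : ℝ) ≤ max A 0 * C₅ ^ (max q 0) * t ^ e := by
      calc a / ((K : ℝ) + 1) * t ^ (2 : ℝ) ≤ lhs K L := h1'
        _ ≤ A * bulk L ^ q := h2
        _ ≤ max A 0 * bulk L ^ q := mul_le_mul_of_nonneg_right (le_max_left _ _) (Real.rpow_nonneg hb0 _)
        _ ≤ max A 0 * (C₅ ^ (max q 0) * t ^ e) := mul_le_mul_of_nonneg_left h3 (le_max_right _ _)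
        _ = max A 0 * C₅ ^ (max q 0) * t ^ e := by ring
    have hK0 : (0 : ℝ) < (K : ℝ) + 1 := by positivity
    rw [Real.rpow_sub ht0, div_le_iff₀ (Real.rpow_pos_of_pos ht0 _)]
    have h5 : a * t ^ (2 : ℝ) ≤ max A 0 * C₅ ^ (max q 0) * ((K : ℝ) + 1) * t ^ e := by
      have := mul_le_mul_of_nonneg_left h4 hK0.le
      calc a * t ^ (2 : ℝ) = ((K : ℝ) + 1) * (a / ((K : ℝ) + 1) * t ^ (2 : ℝ)) := by field_simp
        _ ≤ ((K : ℝ) + 1) * (max A 0 * C₅ ^ (max q 0) * t ^ e) := this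
        _ = max A 0 * C₅ ^ (max q 0) * ((K : ℝ) + 1) * t ^ e := by ring
    rw [hB_def, div_mul_eq_mul_div, le_div_iff₀ ha]
    linarith
  -- Step 2: `L^(2-e)` is unbounded.
  have hexp : 0 < 2 - e := by linarith
  have hB1 : (1 : ℝ) ≤ B := by simpa using key 1 le_rfl
  set T : ℝ := (B + 1) ^ (2 - e)⁻¹ with hT_def
  have hT0 : 0 ≤ T := Real.rpow_nonneg (by linarith) _
  obtain ⟨n, hn⟩ := exists_nat_gt T
  have hL1 : 1 ≤ n + 1 := by omega
  have h6 := key (n + 1) hL1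
  have hlt : T < (((n + 1 : ℕ)) : ℝ) := by push_cast; linarith
  have h7 : T ^ (2 - e) < (((n + 1 : ℕ) : ℝ)) ^ (2 - e) := Real.rpow_lt_rpow hT0 hlt hexp
  have h8 : T ^ (2 - e) = B + 1 := by
    rw [hT_def, Real.rpow_inv_rpow (by linarith) hexp.ne']
  linarith

/-- Quartic floor of the bulk sum: `c₁ · L⁴ ≤ bulk L`, i.e. `√c₁ · L² ≤ √bulk L` (MMS + Simon–Lieb). [folklore] -/
theorem sq_le_sqrt_bulk : ∃ c₁ : ℝ, 0 < c₁ ∧ ∀ L : ℕ, 1 ≤ L → c₁ * (L : ℝ) ^ 2 ≤ Real.sqrt (bulk L) := by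
  obtain ⟨c, hc, hG⟩ := le_axisTwoPoint
  refine ⟨Real.sqrt c, by positivity, fun L hL => ?_⟩
  have hL0 : (0 : ℝ) < L := by exact_mod_cast hL
  have h1 := hG (3 * L) (by omega)
  have h2 := card_sq_mul_axis_le_bulk L
  have hax : axisTwoPoint (3 * L) = criticalTwoPoint 3 (Pi.single 0 (2 * ((3 * L : ℕ) : ℤ))) := rfl
  rw [← hax] at h2
  have hcard : (8 : ℝ) * (L : ℝ) ^ 3 ≤ #(box 3 L) := by
    rw [card_box]; push_cast; nlinarith
  rw [Real.le_sqrt (by positivity) (bulk_pos L).le]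
  calc (Real.sqrt c * (L : ℝ) ^ 2) ^ 2 = c * (L : ℝ) ^ 4 := by rw [mul_pow, Real.sq_sqrt hc.le]; ring
    _ ≤ ((8 : ℝ) * (L : ℝ) ^ 3) ^ 2 * (c / ((3 * L : ℕ) : ℝ) ^ 2) := by
        push_cast
        field_simp
        nlinarith
    _ ≤ (#(box 3 L) : ℝ) ^ 2 * (c / ((3 * L : ℕ) : ℝ) ^ 2) := by gcongr
    _ ≤ (#(box 3 L) : ℝ) ^ 2 * axisTwoPoint (3 * L) := by gcongr
    _ ≤ bulk L := h2

/-- **Every rung `q ≥ 3/4` is PROVABLE now** (`lhs ≤ C₀ L √bulk` and `L ≤ C₁ bulk^{1/4}`), so the open window of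
the ladder is `q ∈ [1/3, 3/4)` with the crux at `q = 1/2`; scaling theory: true iff `q ≥ 1/2`. [folklore] -/
theorem bbsPow_of_ge_three_quarters {q : ℝ} (hq : 3 / 4 ≤ q) :
    ∃ K : ℕ, 2 ≤ K ∧ ∃ A : ℝ, ∀ L : ℕ, 1 ≤ L → lhs K L ≤ A * bulk L ^ q := by
  refine bbsPow_mono hq ?_
  obtain ⟨C₀, hC₀, hup⟩ := lhs_le_mul_sqrt_bulk
  obtain ⟨c₁, hc₁, hlow⟩ := sq_le_sqrt_bulk
  refine ⟨2, le_rfl, C₀ / Real.sqrt c₁, fun L hL => ?_⟩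
  have hL0 : (0 : ℝ) < L := by exact_mod_cast hL
  have h1 := hup 2 L hL
  have h2 := hlow L hL
  have hb0 := (bulk_pos L).le
  set s := Real.sqrt (bulk L) with hs_def
  have hs0 : 0 < s := sqrt_bulk_pos L
  -- `L ≤ √(s/c₁)`
  have hL2 : (L : ℝ) ≤ Real.sqrt (s / c₁) := by
    rw [Real.le_sqrt hL0.le (by positivity), le_div_iff₀ hc₁]
    linarith
  -- `bulk^(3/4) = s · √s`
  have hpow : bulk L ^ (3 / 4 : ℝ) = s * Real.sqrt s := by
    rw [hs_def, Real.sqrt_eq_rpow, Real.sqrt_eq_rpow, ← Real.rpow_mul hb0,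
      ← Real.rpow_add (bulk_pos L)]
    norm_num
  rw [hpow]
  calc lhs 2 L ≤ C₀ * L * s := h1
    _ ≤ C₀ * Real.sqrt (s / c₁) * s := by gcongr
    _ = C₀ / Real.sqrt c₁ * (s * Real.sqrt s) := by
        rw [Real.sqrt_div' _ hc₁.le]  -- √(s/c₁) = √s/√c₁
        field_simp

/-! ## A′. The degenerate slice K = 0 -/

/-- **`2 ≤ K` (really `1 ≤ K`) is load-bearing only degenerately: the slice `K = 0` is FALSE.**  With `K = 0`
the volume is the single site `Λ_0 = {0}` for every `L`, all other spins of the block are frozen to `+1`, so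
`lhs 0 L ≥ |Λ_L| - 1 ≥ 8L³`, against `A·√bulk L ≤ A·C₆·L^{5/2}`. [folklore] -/
theorem bbs_false_without_hK : ¬ ∃ A : ℝ, ∀ L : ℕ, 1 ≤ L → lhs 0 L ≤ A * Real.sqrt (bulk L) := by
  rintro ⟨A, hA⟩
  obtain ⟨C₆, hC₆, hup⟩ := sqrt_bulk_le_pow
  -- lower bound on `lhs 0 L`
  have hlow : ∀ L : ℕ, (8 : ℝ) * (L : ℝ) ^ 3 ≤ lhs 0 L := by
    intro L
    have hbox : box 3 (0 * L) = {0} := by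
      rw [Nat.zero_mul]
      ext z
      simp only [mem_box, Finset.mem_singleton, CharP.cast_eq_zero, neg_zero]
      exact ⟨fun hz => funext fun i => le_antisymm (hz i).2 (hz i).1, fun hz i => by subst hz; simp⟩
    have h1 : ∀ z ∈ (box 3 L).erase 0,
        isingCorr (zdGraph 3) (box 3 (0 * L)) (criticalBeta 3) 0 BoundaryCondition.plus ({z} : Finset (Site 3)) = 1 := by
      intro z hz
      rw [hbox]
      exact isingCorr_plus_singleton_of_not_mem (by simpa using (Finset.mem_erase.1 hz).1) _ _
    have h0 : 0 ≤ isingCorr (zdGraph 3) (box 3 (0 * L)) (criticalBeta 3) 0 BoundaryCondition.plus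
        ({0} : Finset (Site 3)) := by
      rw [hbox]
      exact GKSInequalities.gks_one_holds (G := zdGraph 3) (criticalBeta_nonneg 3) le_rfl (Or.inr rfl)
        (Finset.singleton_subset_iff.2 (Finset.mem_singleton_self 0))
    have hcard : ((#((box 3 L).erase 0) : ℕ) : ℝ) = (2 * L + 1 : ℝ) ^ 3 - 1 := by
      rw [Finset.card_erase_of_mem (zero_mem_box 3 L), card_box]
      have : 1 ≤ (2 * L + 1) ^ 3 := Nat.one_le_pow _ _ (by omega)
      push_cast [Nat.cast_sub this]
      ring
    calc (8 : ℝ) * (L : ℝ) ^ 3 ≤ (2 * L + 1 : ℝ) ^ 3 - 1 + 0 := by nlinarith [sq_nonneg (L : ℝ), Nat.cast_nonneg (α := ℝ) L]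
      _ ≤ (∑ z ∈ (box 3 L).erase 0, isingCorr (zdGraph 3) (box 3 (0 * L)) (criticalBeta 3) 0
            BoundaryCondition.plus ({z} : Finset (Site 3))) +
          isingCorr (zdGraph 3) (box 3 (0 * L)) (criticalBeta 3) 0 BoundaryCondition.plus ({0} : Finset (Site 3)) := by
          rw [Finset.sum_congr rfl h1, Finset.sum_const, nsmul_eq_mul, mul_one, hcard]
          gcongr
      _ = lhs 0 L := by rw [lhs, ← Finset.sum_erase_add _ _ (zero_mem_box 3 L)]
  -- contradiction for large `L`
  have hA0 : 0 ≤ A := by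
    have := (hlow 1).trans (hA 1 le_rfl)
    have hs := sqrt_bulk_pos 1
    by_contra hneg
    push Not at hneg
    have : A * Real.sqrt (bulk 1) < 0 := mul_neg_of_neg_of_pos hneg hs
    norm_num at *
    linarith
  obtain ⟨n, hn⟩ := exists_nat_gt ((A * C₆ / 8) ^ 2)
  set L : ℕ := n + 1 with hL_def
  have hL1 : 1 ≤ L := by omega
  have hLpos : (0 : ℝ) < L := by positivity
  have key := (hlow L).trans ((hA L hL1).trans (mul_le_mul_of_nonneg_left (hup L hL1) hA0))
  -- `8 L³ ≤ A C₆ L^{5/2}` ⇒ `L^{1/2} ≤ A C₆ / 8`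
  have h3 : (L : ℝ) ^ 3 = (L : ℝ) ^ (5 / 2 : ℝ) * (L : ℝ) ^ (1 / 2 : ℝ) := by
    rw [← Real.rpow_add hLpos, ← Real.rpow_natCast]; norm_num
  rw [h3] at key
  have h52 : 0 < (L : ℝ) ^ (5 / 2 : ℝ) := Real.rpow_pos_of_pos hLpos _
  have h4 : (L : ℝ) ^ (1 / 2 : ℝ) ≤ A * C₆ / 8 := by
    have : 8 * (L : ℝ) ^ (1 / 2 : ℝ) * (L : ℝ) ^ (5 / 2 : ℝ) ≤ A * C₆ * (L : ℝ) ^ (5 / 2 : ℝ) := by nlinarith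
    have := le_of_mul_le_mul_right this h52
    linarith
  have h5 : (L : ℝ) ≤ (A * C₆ / 8) ^ 2 := by
    have hh : 0 ≤ (L : ℝ) ^ (1 / 2 : ℝ) := Real.rpow_nonneg hLpos.le _
    have := pow_le_pow_left₀ hh h4 2
    rwa [← Real.rpow_natCast, ← Real.rpow_mul hLpos.le, show (1 / 2 : ℝ) * ((2 : ℕ) : ℝ) = 1 by norm_num,
      Real.rpow_one] at this
  have h6 : (n : ℝ) < L := by rw [hL_def]; push_cast; linarith
  linarith

/-! ## D. What a refutation must deliver -/

/-- What a refutation must deliver: an unbounded ratio at EVERY aspect ratio `K ≥ 2`. [folklore] -/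
theorem not_bbs_iff : ¬ BoundedBoundarySignal ↔
    ∀ K : ℕ, 2 ≤ K → ∀ A : ℝ, ∃ L : ℕ, 1 ≤ L ∧ A * Real.sqrt (bulk L) < lhs K L := by
  simp only [bbs_iff, not_exists, not_and, not_forall, not_le, exists_prop]

end Summit.CriticalPhenomena.Ising3DConformalLimit.Cruxes.BoundedBoundarySignal.Disproof

end
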